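import Literature.Topology.FourManifolds.LefschetzBasePages
import Literature.Topology.FourManifolds.CircleMapsConjugateLoops
import Literature.Topology.FourManifolds.Isotopy
import Summits.SmoothPoincare4.SmoothPoincare4.Theorems.ConvexBisectionAcyclicBisectionExistsKasLoops
import HarnessLib

/-!
# The homology shadow of a loop in the Lefschetz base is a free-homotopy invariant
(wave 2, brick (M3a) of stub `stub_modelsOnFibred_of_reach` = NF4
`Literature.Topology.FourManifolds.LefschetzBase.modelsOnFibred_of_reach`, line `modp-braid-orbits`
r11, crux `ConvexBisection.AcyclicBisectionExists`, item stmt-SmoothPoincare4-10508; registered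
sub-goal `helper_shadow_eq_of_homotopy`)

The homology shadow `shadow g K hK = shadowMap g (h[K])` of a loop `K : 𝕊¹ → Base g`
(`LefschetzBasePages.lean` §7; `h[K] = loopClass ℤ ℤ 1 (loopPath K hK) ∈ H₁(Base g; ℤ)` the
Hurewicz class of the unit-period loop `t ↦ K (e^{2πit})`) only depends on the FREE homotopy class
of `K`: every geometric step of (HS)/(ST) for NF4 (and of T1 of NF6, NF1) moves attaching circles by
ambient isotopies of `Base g`, by isotopies of the circles in `∂ Base g`, or re-parametrises them, and
must know that the shadow does not change.  Everything here is a corollary of the homotopy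
invariance and naturality of singular homology (`singularHomology.map_eq_of_homotopic`,
`map_loopClass`; the `ℤ`-coefficient form `loopClass_int_loopPath_eq_of_homotopic` is re-derived
here with the coefficient instances of `shadow`, cf. `loopClass_loopPath_eq_of_homotopic` of
`…MultiAttachmentH1Model.lean` for `loopClass R R 1`) and of the descent of `[0, 1]²`-families of
closed loops with moving base points to homotopies of circle maps
(`loopCircleMap_homotopic_of_family`, `CircleMapsConjugateLoops.lean`):

* `shadow_eq_of_homotopic` — homotopic circle maps have the same shadow;
* `shadow_eq_of_family`, `helper_shadow_eq_of_homotopy` — a family `H s : 𝕊¹ → Base g`, jointly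
  continuous on `[0, 1] × 𝕊¹`, has `shadow (H 0) = shadow (H 1)`;
* `shadow_eq_of_loop_family` — the same for a family of closed loops `G s : [0, 1] → Base g`
  (base points may move) interpolating the unit-period loops of `K` and `K'`;
* `shadow_comp_eq_of_homotopic_id`, `shadow_comp_ambientIsotopy`,
  `shadow_comp_eq_of_isSmoothlyIsotopic`, `shadow_comp_diffeomorph_of_isIsotopic_refl` —
  post-composition with a map homotopic to the identity (a stage of an ambient isotopy, a
  diffeomorphism isotopic to the identity) does not change the shadow;
* `shadow_eq_of_smoothIsotopy`, `shadow_eq_of_isSmoothlyIsotopic` — isotopic loops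
  (`SmoothIsotopy (𝓡 1) (𝓡∂ 4) K₀ K₁`, the carrier of `KnotIsotopyInBoundary`) have the same shadow;
* `shadow_comp_eq_of_homotopic_id_circle`, `shadow_eq_of_rotate`, `shadow_eq_neg_of_reverse` —
  re-parametrisation by a circle map homotopic to the identity, in particular by a rotation
  `e^{2πit} ↦ e^{2πi(t + a)}`, does not change the shadow; reversal `e^{2πit} ↦ e^{−2πit}` negates
  it (`stub_Kas_loopClass_reverse`, `…KasLoops.lean`).

Everything is proved; no named facts, no `sorry`.  The circle is written
`sphere (0 : EuclideanSpace ℝ (Fin 2)) 1` throughout (no local notation in `Theorems/`).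
References: A. Hatcher, *Algebraic Topology* (2002), Thm. 2.10, Thm. 2A.1 and §1.1 Ex. 6
[HatcherAT2002]; J. Milnor, *Singular points of complex hypersurfaces* (1968), Thm. 9.1 [Milnor1968].
-/

noncomputable section

set_option linter.dupNamespace false

open scoped Manifold ContDiff Topology unitInterval
open Set Function Metric
open Literature.Topology.FourManifolds Literature.Topology.FourManifolds.LefschetzBase
  Literature.AlgebraicTopology.SingularHomology

namespace Summit.SmoothPoincare4.SmoothPoincare4.Theorems.AcyclicBisectionExists.ModpBraidOrbits

variable {g : ℕ} {K K' K₀ K₁ : sphere (0 : EuclideanSpace ℝ (Fin 2)) 1 → Base g}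

/-! ## §1 Homotopic circle maps have the same Hurewicz class and the same shadow -/

/-- **Homotopic maps of the circle have unit-period loops with the same Hurewicz class in
`H₁(X; ℤ)`** (`ℤ`-coefficients with the instances used by `shadow`): both classes are the images
of the class of the unit-period loop of `𝕊¹` under `(K₀)_* = (K₁)_*` (naturality `map_loopClass`,
homotopy invariance `singularHomology.map_eq_of_homotopic`). [cite: HatcherAT2002, Thm. 2.10] -/
theorem loopClass_int_loopPath_eq_of_homotopic {X : Type} [TopologicalSpace X]
    {L₀ L₁ : sphere (0 : EuclideanSpace ℝ (Fin 2)) 1 → X} (h₀ : Continuous L₀) (h₁ : Continuous L₁)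
    (h : (⟨L₀, h₀⟩ : C(sphere (0 : EuclideanSpace ℝ (Fin 2)) 1, X)).Homotopic ⟨L₁, h₁⟩) :
    loopClass ℤ ℤ (1 : ℤ) (loopPath L₀ h₀) = loopClass ℤ ℤ (1 : ℤ) (loopPath L₁ h₁) := by
  have e : ∀ {L : sphere (0 : EuclideanSpace ℝ (Fin 2)) 1 → X} (hL : Continuous L),
      loopClass ℤ ℤ (1 : ℤ) (loopPath L hL) =
        singularHomology.map ℤ ℤ (⟨L, hL⟩ : C(sphere (0 : EuclideanSpace ℝ (Fin 2)) 1, X)) 1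
          (loopClass ℤ ℤ (1 : ℤ) (loopPath (id : sphere (0 : EuclideanSpace ℝ (Fin 2)) 1 →
            sphere (0 : EuclideanSpace ℝ (Fin 2)) 1) continuous_id)) := by
    intro L hL
    rw [map_loopClass]
    exact loopClass_eq_of_ofPath_eq _ _ _ _ _ rfl
  rw [e h₀, e h₁, singularHomology.map_eq_of_homotopic ℤ ℤ h]

/-- **Homotopic maps of the circle into the base have the same homology shadow.**
[cite: HatcherAT2002, Thm. 2A.1] -/
theorem shadow_eq_of_homotopic (h₀ : Continuous K₀) (h₁ : Continuous K₁)
    (h : (⟨K₀, h₀⟩ : C(sphere (0 : EuclideanSpace ℝ (Fin 2)) 1, Base g)).Homotopic ⟨K₁, h₁⟩) :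
    shadow g K₀ h₀ = shadow g K₁ h₁ := by
  unfold shadow
  rw [loopClass_int_loopPath_eq_of_homotopic h₀ h₁ h]

/-- **A jointly continuous family of circle maps has constant shadow**: if
`H : ℝ → 𝕊¹ → Base g` is jointly continuous on `[0, 1] × 𝕊¹` with `H 0 = K₀` and `H 1 = K₁`
pointwise, then `shadow K₀ = shadow K₁`. [cite: HatcherAT2002, Thm. 2A.1] -/
theorem shadow_eq_of_family (H : ℝ → sphere (0 : EuclideanSpace ℝ (Fin 2)) 1 → Base g)
    (hH : ContinuousOn (uncurry H) (Icc (0 : ℝ) 1 ×ˢ univ))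
    (h₀ : Continuous K₀) (h₁ : Continuous K₁) (e₀ : ∀ θ, H 0 θ = K₀ θ) (e₁ : ∀ θ, H 1 θ = K₁ θ) :
    shadow g K₀ h₀ = shadow g K₁ h₁ := by
  refine shadow_eq_of_homotopic h₀ h₁ ⟨?_⟩
  exact
    { toFun := fun p => H (p.1 : ℝ) p.2
      continuous_toFun := hH.comp_continuous
        ((continuous_subtype_val.comp continuous_fst).prodMk continuous_snd)
        fun p => ⟨p.1.2, mem_univ _⟩
      map_zero_left := e₀
      map_one_left := e₁ }

/-- **Sub-goal `helper_shadow_eq_of_homotopy` of stub `stub_modelsOnFibred_of_reach`** (NF4, wave 2,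
brick (M3a)): a family of loops `H s : 𝕊¹ → Base g`, jointly continuous on `[0, 1] × 𝕊¹`, has
constant homology shadow: `shadow (H 0) = shadow (H 1)`. [cite: HatcherAT2002, Thm. 2A.1] -/
theorem helper_shadow_eq_of_homotopy :
    ∀ (g : ℕ) (H : ℝ → Metric.sphere (0 : EuclideanSpace ℝ (Fin 2)) 1 →
        Literature.Topology.FourManifolds.LefschetzBase.Base g)
      (_ : ContinuousOn (Function.uncurry H) (Set.Icc (0 : ℝ) 1 ×ˢ Set.univ))
      (h0 : Continuous (H 0)) (h1 : Continuous (H 1)),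
      Literature.Topology.FourManifolds.LefschetzBase.shadow g (H 0) h0 =
        Literature.Topology.FourManifolds.LefschetzBase.shadow g (H 1) h1 :=
  fun _ H hH h0 h1 => shadow_eq_of_family H hH h0 h1 (fun _ => rfl) fun _ => rfl

/-! ## §2 Families of closed loops on `[0, 1]` with moving base points -/

/-- **A continuous family of closed loops `G s : [0, 1] → Base g` (base points may move)
interpolating the unit-period loops of `K` and `K'` forces `shadow K = shadow K'`**: the family
descends to a homotopy of circle maps (`loopCircleMap_homotopic_of_family`; the unit-period loop
`t ↦ K (e^{2πit})` descends back to `K` since `circleParam t = circlePt t`).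
[cite: HatcherAT2002, §1.1, proof of Lemma 1.19] -/
theorem shadow_eq_of_loop_family (hK : Continuous K) (hK' : Continuous K')
    (G : ℝ → ℝ → Base g) (hG : ContinuousOn (uncurry G) (Icc (0 : ℝ) 1 ×ˢ Icc (0 : ℝ) 1))
    (hloop : ∀ s ∈ Icc (0 : ℝ) 1, G s 0 = G s 1)
    (hG0 : ∀ t ∈ Icc (0 : ℝ) 1, G 0 t = K (circlePt t))
    (hG1 : ∀ t ∈ Icc (0 : ℝ) 1, G 1 t = K' (circlePt t)) :
    shadow g K hK = shadow g K' hK' := by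
  -- the unit-period loops of `K`, `K'` on the unit interval, and their descent back to `K`, `K'`
  let γ : ∀ {L : sphere (0 : EuclideanSpace ℝ (Fin 2)) 1 → Base g}, Continuous L → C(I, Base g) :=
    fun {L} hL => ⟨fun t => L (circlePt t), hL.comp (continuous_circlePt.comp continuous_subtype_val)⟩
  have hγ : ∀ {L : sphere (0 : EuclideanSpace ℝ (Fin 2)) 1 → Base g} (hL : Continuous L),
      γ hL 0 = γ hL 1 := fun {L} hL => by
    show L (circlePt (0 : ℝ)) = L (circlePt (1 : ℝ))
    rw [← circlePt_add_one 0, zero_add]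
  have hdesc : ∀ {L : sphere (0 : EuclideanSpace ℝ (Fin 2)) 1 → Base g} (hL : Continuous L),
      loopCircleMap (γ hL) (hγ hL) = ⟨L, hL⟩ := fun {L} hL => by
    ext u
    obtain ⟨t, rfl⟩ := circleParam_surjective u
    rw [loopCircleMap_circleParam]
    rfl
  -- the family on the closed square
  let G' : C(I × I, Base g) := ⟨fun p => G (p.1 : ℝ) (p.2 : ℝ), hG.comp_continuous
    ((continuous_subtype_val.comp continuous_fst).prodMk (continuous_subtype_val.comp continuous_snd))
    fun p => ⟨p.1.2, p.2.2⟩⟩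
  have hfam := loopCircleMap_homotopic_of_family G' (fun s => hloop s s.2) (hγ hK) (hγ hK')
    (fun t => hG0 t t.2) (fun t => hG1 t t.2)
  rw [hdesc hK, hdesc hK'] at hfam
  exact shadow_eq_of_homotopic hK hK' hfam

/-! ## §3 Post-composition with maps homotopic to the identity -/

/-- **Post-composition with a self-map of the base homotopic to the identity does not change the
shadow.** [cite: HatcherAT2002, Thm. 2A.1] -/
theorem shadow_comp_eq_of_homotopic_id (R : C(Base g, Base g))
    (hR : R.Homotopic (ContinuousMap.id (Base g))) (hK : Continuous K) (h' : Continuous (R ∘ K)) :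
    shadow g (R ∘ K) h' = shadow g K hK :=
  shadow_eq_of_homotopic h' hK (hR.comp (ContinuousMap.Homotopic.refl ⟨K, hK⟩))

/-- **Every stage of an ambient isotopy of the base preserves shadows**: `shadow (R_s ∘ K) =
shadow K` (the stages `R_{rs}`, `r ∈ [0, 1]`, connect `R_0 = id` to `R_s`).
[cite: HatcherAT2002, Thm. 2A.1] -/
theorem shadow_comp_ambientIsotopy (R : AmbientIsotopy (𝓡∂ 4) (Base g)) (s : ℝ)
    (hK : Continuous K) (h' : Continuous (R.toFun s ∘ K)) :
    shadow g (R.toFun s ∘ K) h' = shadow g K hK := by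
  have hc : Continuous (uncurry R.toFun) := R.contMDiff.continuous
  refine (shadow_eq_of_family (fun r θ => R.toFun (r * s) (K θ)) ?_ hK h'
    (fun θ => ?_) (fun θ => ?_)).symm
  · exact (hc.comp ((continuous_fst.mul continuous_const).prodMk
      (hK.comp continuous_snd))).continuousOn
  · show R.toFun (0 * s) (K θ) = K θ
    rw [zero_mul, R.map_zero]; rfl
  · show R.toFun (1 * s) (K θ) = R.toFun s (K θ)
    rw [one_mul]

/-- **Smoothly isotopic self-maps of the base give the same shadows after post-composition.**
[cite: HatcherAT2002, Thm. 2A.1] -/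
theorem shadow_comp_eq_of_isSmoothlyIsotopic {f₀ f₁ : Base g → Base g}
    (h : IsSmoothlyIsotopic (𝓡∂ 4) (𝓡∂ 4) f₀ f₁) (hK : Continuous K)
    (h₀ : Continuous (f₀ ∘ K)) (h₁ : Continuous (f₁ ∘ K)) :
    shadow g (f₀ ∘ K) h₀ = shadow g (f₁ ∘ K) h₁ := by
  obtain ⟨F⟩ := h
  have hc : Continuous (uncurry F.toFun) := F.contMDiff.continuous
  refine shadow_eq_of_family (fun r θ => F.toFun r (K θ)) ?_ h₀ h₁ (fun θ => ?_) (fun θ => ?_)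
  · exact (hc.comp (continuous_fst.prodMk (hK.comp continuous_snd))).continuousOn
  · show F.toFun 0 (K θ) = f₀ (K θ)
    rw [F.map_zero]
  · show F.toFun 1 (K θ) = f₁ (K θ)
    rw [F.map_one]

/-- **A self-diffeomorphism of the base isotopic to the identity preserves shadows** (the form in
which the end `Ξ` of a boundary diffeotopy is delivered by the ISO chain of
`TwoHandleIsotopyHolds.lean`). [cite: HatcherAT2002, Thm. 2A.1] -/
theorem shadow_comp_diffeomorph_of_isIsotopic_refl (Ξ : Base g ≃ₘ⟮𝓡∂ 4, 𝓡∂ 4⟯ Base g)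
    (hΞ : Literature.Topology.FourManifolds.Diffeomorph.IsIsotopic Ξ
      (Diffeomorph.refl (𝓡∂ 4) (Base g) ∞))
    (hK : Continuous K) (h' : Continuous (Ξ ∘ K)) :
    shadow g (Ξ ∘ K) h' = shadow g K hK :=
  shadow_comp_eq_of_isSmoothlyIsotopic hΞ hK h' hK

/-! ## §4 Isotopic loops -/

/-- **Smoothly isotopic loops have the same shadow** (`SmoothIsotopy (𝓡 1) (𝓡∂ 4) K₀ K₁` is the
carrier of `KnotIsotopyInBoundary K₀ K₁`, the datum moved by the ISO chain).
[cite: HatcherAT2002, Thm. 2A.1] -/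
theorem shadow_eq_of_smoothIsotopy (F : SmoothIsotopy (𝓡 1) (𝓡∂ 4) K₀ K₁)
    (h₀ : Continuous K₀) (h₁ : Continuous K₁) : shadow g K₀ h₀ = shadow g K₁ h₁ := by
  have hc : Continuous (uncurry F.toFun) := F.contMDiff.continuous
  refine shadow_eq_of_family F.toFun hc.continuousOn h₀ h₁ (fun θ => ?_) (fun θ => ?_)
  · rw [F.map_zero]
  · rw [F.map_one]

/-- Smoothly isotopic loops have the same shadow (`Prop`-valued form).
[cite: HatcherAT2002, Thm. 2A.1] -/
theorem shadow_eq_of_isSmoothlyIsotopic (h : IsSmoothlyIsotopic (𝓡 1) (𝓡∂ 4) K₀ K₁)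
    (h₀ : Continuous K₀) (h₁ : Continuous K₁) : shadow g K₀ h₀ = shadow g K₁ h₁ := by
  obtain ⟨F⟩ := h
  exact shadow_eq_of_smoothIsotopy F h₀ h₁

/-! ## §5 Re-parametrisation -/

/-- **Re-parametrisation by a circle map homotopic to the identity does not change the shadow.**
[cite: HatcherAT2002, Thm. 2A.1] -/
theorem shadow_comp_eq_of_homotopic_id_circle
    (ρ : C(sphere (0 : EuclideanSpace ℝ (Fin 2)) 1, sphere (0 : EuclideanSpace ℝ (Fin 2)) 1))
    (hρ : ρ.Homotopic (ContinuousMap.id _)) (hK : Continuous K) (h' : Continuous (K ∘ ρ)) :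
    shadow g (K ∘ ρ) h' = shadow g K hK :=
  shadow_eq_of_homotopic h' hK ((ContinuousMap.Homotopic.refl ⟨K, hK⟩).comp hρ)

/-- **Rotating the parametrisation does not change the shadow**: if `K' (e^{2πit}) =
K (e^{2πi(t + a)})` for all `t`, then `shadow K' = shadow K` (the loops `t ↦ K (e^{2πi(t + sa)})`,
`s ∈ [0, 1]`, are closed with moving base point). [cite: HatcherAT2002, §1.1, proof of Lemma 1.19] -/
theorem shadow_eq_of_rotate (hK : Continuous K) (hK' : Continuous K') (a : ℝ)
    (h : ∀ t : ℝ, K' (circlePt t) = K (circlePt (t + a))) :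
    shadow g K' hK' = shadow g K hK := by
  refine (shadow_eq_of_loop_family hK hK' (fun s t => K (circlePt (t + s * a))) ?_ ?_ ?_ ?_).symm
  · exact (hK.comp (continuous_circlePt.comp
      (continuous_snd.add (continuous_fst.mul continuous_const)))).continuousOn
  · intro s _
    show K (circlePt (0 + s * a)) = K (circlePt (1 + s * a))
    rw [zero_add, add_comm, circlePt_add_one]
  · intro t _
    show K (circlePt (t + 0 * a)) = K (circlePt t)
    rw [zero_mul, add_zero]
  · intro t _
    show K (circlePt (t + 1 * a)) = K' (circlePt t)
    rw [one_mul, h]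

/-- **Reversing the parametrisation negates the shadow**: if `K' (e^{2πit}) = K (e^{−2πit})` for all
`t`, then `shadow K' = −shadow K` (`stub_Kas_loopClass_reverse` and linearity of `shadowMap`).
[cite: HatcherAT2002, Thm. 2A.1] -/
theorem shadow_eq_neg_of_reverse (hK : Continuous K) (hK' : Continuous K')
    (h : ∀ t : ℝ, K' (circlePt t) = K (circlePt (-t))) :
    shadow g K' hK' = -shadow g K hK := by
  unfold shadow
  rw [stub_Kas_loopClass_reverse (Base g) K K' hK hK' h, map_neg]

end Summit.SmoothPoincare4.SmoothPoincare4.Theorems.AcyclicBisectionExists.ModpBraidOrbits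

end
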